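import Summits.AtomisticToContinuum.HydrodynamicLimit.Theorems.InformationPercolationEngineLocalSecondLawInitialMatchingTerm1
import Summits.AtomisticToContinuum.HydrodynamicLimit.Theorems.JParityClosureLocalSecondLawContactPinnedRepresentationMeans
import Summits.AtomisticToContinuum.HydrodynamicLimit.Theorems.JParityClosureLocalSecondLawInitialLayer

/-!
# Stub B′|ML (`stub_initialMatchingOfStatics`) of the line `contact-asymmetry-information` for the crux `LocalSecondLaw`
(stmt-AtomisticToContinuum-13081) — part 6a: pointwise bookkeeping for the initial matching

Four inputs of the final assembly of B′ (`|initialGapEns| ≤ η`):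
* `pw_hKinBar_sub_Hs_eq` — the algebraic split of the pointwise gap at a centre `x`:
  `h̄_kin(0,x) − Hs(n(x), θ₀(x)) = (h̄ − A) + (A − P(x)) + c₀ (ρ̄ − n(x)) + (ρ̄ f_ex(ρ̄σ³) − n f_ex(nσ³))`,
  `P = n log n − (3/2) log(2πθ₀) n − (3/2) n` (the guard of `Hs` is off at `n, θ₀ > 0`; `A` is free — it is the cone smearing of `P`
  in the application);
* `pw_integrable_h1` — the kinetic entropy density `h₁(0,·)` of the one-particle density of a bounded tilt is integrable on `𝕋³`
  (its a.e. decomposition, part 5a, has integrable pieces);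
* `pw_continuous_hBar`, `pw_continuous_hKinBar` — hence `h̄(0,·)` is continuous (dominated convergence against the cone), and so is
  `h̄_kin(0,·)` as long as the mean coarse density stays inside the equation-of-state band (`f_ex = F` continuous there); in
  particular `x ↦ h̄_kin(0,x) φ(0,x)` is integrable, which the DEFINITION of `initialGapEns` as a difference of two integrals needs;
* `pw_eos_modulus` — uniform continuity of `t ↦ t f_ex(tσ³)` on `[0, T]` when `Tσ³ < η₀` (Heine–Cantor near a compact,
  `initL_unif_near_compact`).

References: H. Spohn, *Large Scale Dynamics of Interacting Particles* (1991), Part I §2.3–§3.  Lead c16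
(prover-line-stmt-AtomisticToContinuum-13081-c16-0).
-/

noncomputable section

open scoped BigOperators Topology Classical MeasureTheory ENNReal InnerProductSpace
open Filter Set MeasureTheory Function
open Literature.MathematicalPhysics.KineticTheory
open Literature.Analysis.FluidPDE
open Summit.AtomisticToContinuum.HydrodynamicLimit.Theorems.LocalSecondLawNegative
open Summit.AtomisticToContinuum.HydrodynamicLimit.Theorems.LocalSecondLawLedger
open Summit.AtomisticToContinuum.HydrodynamicLimit.Theorems.LocalSecondLawContact

namespace Summit.AtomisticToContinuum.HydrodynamicLimit.Theorems.LocalSecondLawInitialMatching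

variable {N : ℕ}

/-! ### The algebraic split of the pointwise gap -/

/-- **The pointwise gap of the initial matching, split into its four sources** (at a centre `x` with `n(x), θ₀(x) > 0`). -/
theorem pw_hKinBar_sub_Hs_eq {σ r : ℝ} (f : Pt1 → ℝ) (ν : Measure (Phase N)) (Φ : Flow σ N) (x : T3) {a b : ℝ}
    (ha : 0 < a) (hb : 0 < b) (A : ℝ) :
    hKinBar σ r f ν Φ 0 x - Hs σ a b =
      (hBar r f 0 x - A) + (A - (a * Real.log a - 3 / 2 * Real.log (2 * Real.pi * b) * a - 3 / 2 * a)) +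
        c0 * (rhoBar r ν Φ 0 x - a) +
        (rhoBar r ν Φ 0 x * hsExcessFreeEnergy (rhoBar r ν Φ 0 x * σ ^ 3) - a * hsExcessFreeEnergy (a * σ ^ 3)) := by
  have hHs : Hs σ a b = a * Real.log a - 3 / 2 * a * Real.log b + a * hsExcessFreeEnergy (a * σ ^ 3) := by
    unfold Hs; rw [if_pos ⟨ha, hb⟩]; ring
  have hlog : Real.log (2 * Real.pi * b) = Real.log (2 * Real.pi) + Real.log b :=
    Real.log_mul (by positivity) hb.ne'
  unfold hKinBar c0
  rw [hHs, hlog]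
  ring

/-! ### Integrability of the kinetic entropy density and continuity of its smearing -/

/-- **`h₁(0,·)` is integrable on `𝕋³`** for the one-particle density of a bounded tilt of the local Gibbs law (continuous
profiles, `σ ≤ 1/2` in the cluster regime, `P_N(S) ≥ δ″ > 0`, `τ ≥ 0`). -/
theorem pw_integrable_h1 {a₀ θ₀ : T3 → ℝ} {u₀ : T3 → V3} (ha : Continuous a₀) (hθ : Continuous θ₀) (hu : Continuous u₀)
    (ha0 : ∀ x, 0 < a₀ x) (hθ0 : ∀ x, 0 < θ₀ x) {σ : ℝ} (hσ : σ ≤ 1 / 2) (hs : SmallDensity (profileOf a₀ ha ha0) σ)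
    {τ : ℝ} (hτ : 0 ≤ τ) (Φ : Flow σ N) (S : Set (Phase N)) {δ'' : ℝ} (hδ : 0 < δ'')
    (hS : ENNReal.ofReal δ'' ≤ localGibbsLaw σ a₀ u₀ θ₀ N Φ S) (f : Pt1 → ℝ)
    (hf : IsOneParticleDensity τ (condLaw (localGibbsLaw σ a₀ u₀ θ₀ N Φ) S) Φ f) :
    Integrable fun y : T3 => h1 f 0 y := by
  set μ : Measure (Phase N) := localGibbsLaw σ a₀ u₀ θ₀ N Φ with hμ
  haveI : IsProbabilityMeasure μ := isProbabilityMeasure_localGibbsLaw ha hθ hu ha0 hθ0 hσ N Φ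
  haveI : IsProbabilityMeasure (condLaw μ S) := contactB_condLaw_isProbability_of_floor μ S δ'' hδ hS
  have hS0 : μ S ≠ 0 := fun h0 => by
    rw [h0] at hS
    exact absurd (nonpos_iff_eq_zero.1 hS) (by rw [ENNReal.ofReal_eq_zero]; linarith)
  have hf0 : ∀ p, 0 ≤ f p := fun p => hf.1 p
  set nS : T3 → ℝ := fun y => ∫ v : V3, f (0, y, v) with hnS
  have hnSm : Measurable nS := tv_measurable_posDensity hf
  have hnSi : Integrable nS := tv_integrable_posDensity (condLaw μ S) Φ f hτ hf
  have hnS0 : ∀ y, 0 ≤ nS y := fun y => tv_posDensity_nonneg hf y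
  -- the pieces
  obtain ⟨hFLi, -⟩ := kl_velocity_budget ha hθ hu ha0 hθ0 hσ hτ Φ S f hS0 hf
  obtain ⟨h3i, -⟩ := en_energy_matching ha hθ hu ha0 hθ0 hσ hτ Φ S hδ hS f hf (fun _ => (1 : ℝ)) measurable_const
    (fun _ => zero_le_one) (fun _ => le_rfl)
  have hqFi : Integrable fun p : T3 × V3 => ‖p.2 - u₀ p.1‖ ^ 2 / (2 * θ₀ p.1) * f (0, p) :=
    h3i.congr (ae_of_all _ fun p => by simp only [one_mul])
  obtain ⟨hki, -⟩ := t1_integral_slice hFLi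
  obtain ⟨hei, -⟩ := t1_integral_slice hqFi
  -- `nS log nS` and `log(2πθ₀) nS`
  set K' : ℝ := max 1 (2 * (profileOf a₀ ha ha0).M / δ'') with hK'
  have hK'1 : 1 ≤ K' := le_max_left _ _
  have hnSK : ∀ᵐ y : T3, nS y ≤ K' := by
    filter_upwards [tv_posDensity_le_ae ha hθ hu ha0 hθ0 hσ hs Φ S hδ hS hτ hf] with y hy
    exact hy.trans (le_max_right _ _)
  have hnSlog_i : Integrable fun y => Real.log (nS y) * nS y := by
    refine (integrable_const (K' * Real.log K' + 1)).mono' ((Real.measurable_log.comp hnSm).mul hnSm).aestronglyMeasurable ?_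
    filter_upwards [hnSK] with y hy
    rw [Real.norm_eq_abs, mul_comm]
    exact em_abs_mul_log_le (hnS0 y) hy hK'1
  have hlgc : Continuous fun y => Real.log (2 * Real.pi * θ₀ y) :=
    (continuous_const.mul hθ).log fun y => (mul_pos (by positivity) (hθ0 y)).ne'
  obtain ⟨L, -, hL'⟩ := exists_forall_abs_le_of_continuous hlgc
  have hlg_i : Integrable fun y => 3 / 2 * Real.log (2 * Real.pi * θ₀ y) * nS y := by
    have hm : Measurable fun y => Real.log (2 * Real.pi * θ₀ y) := Real.measurable_log.comp (hθ.measurable.const_mul _)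
    have h1 : Integrable fun y => Real.log (2 * Real.pi * θ₀ y) * nS y :=
      hnSi.bdd_mul hm.aestronglyMeasurable (ae_of_all _ fun y => by rw [Real.norm_eq_abs]; exact hL' y)
    exact (h1.const_mul (3 / 2)).congr (ae_of_all _ fun y => by ring)
  -- a.e. decomposition
  have hgood := t1_ae_good ha hθ hu ha0 hθ0 hσ hτ Φ S hδ hS f hf
  have hdec : (fun y => h1 f 0 y) =ᵐ[volume] fun y =>
      (∫ v : V3, f (0, y, v) * Real.log (f (0, y, v) / ((∫ w, f (0, y, w)) * localMaxwellian 1 (θ₀ y) (u₀ y) v))) +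
        Real.log (nS y) * nS y - 3 / 2 * Real.log (2 * Real.pi * θ₀ y) * nS y -
          ∫ v : V3, ‖v - u₀ y‖ ^ 2 / (2 * θ₀ y) * f (0, y, v) := by
    filter_upwards [hgood] with y hy
    exact (t1_h1_eq hθ0 hf0 hy.1 hy.2.1 hy.2.2).2
  refine Integrable.congr ?_ hdec.symm
  exact ((hki.add hnSlog_i).sub hlg_i).sub hei

/-- **The cone-smeared kinetic entropy `h̄(0,·)` is continuous in the centre** (dominated convergence; `h₁(0,·) ∈ L¹`). -/
theorem pw_continuous_hBar {r : ℝ} (hr : 0 < r) {f : Pt1 → ℝ} (hh1 : Integrable fun y : T3 => h1 f 0 y) :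
    Continuous fun x : T3 => hBar r f 0 x := by
  unfold hBar
  refine continuous_of_dominated (F := fun x y => cone r y x * h1 f 0 y) (bound := fun y => 3 / (Real.pi * r ^ 3) * |h1 f 0 y|)
    (fun x => (contactB_continuous_cone_left r x).aestronglyMeasurable.mul hh1.aestronglyMeasurable)
    (fun x => Eventually.of_forall fun y => ?_) (hh1.abs.const_mul _)
    (Eventually.of_forall fun y => (continuous_cone r y).mul continuous_const)
  rw [Real.norm_eq_abs, abs_mul, abs_of_nonneg (cone_nonneg hr y x)]
  exact mul_le_mul_of_nonneg_right (contactB_cone_le_const hr y x) (abs_nonneg _)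

/-- The mean coarse density of a law is non-negative. -/
theorem pw_rhoBar_nonneg {σ r : ℝ} (hr : 0 < r) (ν : Measure (Phase N)) (Φ : Flow σ N) (s : ℝ) (x : T3) :
    0 ≤ rhoBar r ν Φ s x :=
  integral_nonneg fun _ => rhoC_nonneg hr _ _

/-- **`h̄_kin(0,·)` is continuous in the centre inside the equation-of-state band**: if `h̄(0,·)` is continuous, the law is finite,
`σ, r > 0`, and the mean coarse density satisfies `ρ̄ σ³ < η₀` everywhere, where `f_ex = F` on `[0,η₀)` with `F` continuous on
`(−η₀, η₀)` (`EosBand`). -/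
theorem pw_continuous_hKinBar {η₀ σ r : ℝ} {F : ℝ → ℝ} (hB : EosBand η₀ F) (hσ : 0 < σ) (hr : 0 < r) (f : Pt1 → ℝ)
    (ν : Measure (Phase N)) [IsFiniteMeasure ν] (Φ : Flow σ N) (hbar : Continuous fun x : T3 => hBar r f 0 x)
    (hband : ∀ x, rhoBar r ν Φ 0 x * σ ^ 3 < η₀) :
    Continuous fun x : T3 => hKinBar σ r f ν Φ 0 x := by
  have hρc : Continuous fun x => rhoBar r ν Φ 0 x := continuous_rhoBar hr Φ ν 0
  have hFc : ContinuousOn F (Set.Ioo (-η₀) η₀) := hB.2.1.continuousOn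
  have hmem : ∀ x, rhoBar r ν Φ 0 x * σ ^ 3 ∈ Set.Ioo (-η₀) η₀ := fun x =>
    ⟨by
      have h0 : 0 ≤ rhoBar r ν Φ 0 x * σ ^ 3 :=
        mul_nonneg (pw_rhoBar_nonneg hr ν Φ 0 x) (pow_pos hσ 3).le
      linarith [hB.1], hband x⟩
  have hcomp : Continuous fun x => F (rhoBar r ν Φ 0 x * σ ^ 3) :=
    hFc.comp_continuous (hρc.mul continuous_const) hmem
  have heq : (fun x => hsExcessFreeEnergy (rhoBar r ν Φ 0 x * σ ^ 3)) = fun x => F (rhoBar r ν Φ 0 x * σ ^ 3) := by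
    funext x
    exact hB.2.2 ⟨mul_nonneg (pw_rhoBar_nonneg hr ν Φ 0 x) (pow_pos hσ 3).le, hband x⟩
  unfold hKinBar
  refine (hbar.add (continuous_const.mul hρc)).add (hρc.mul ?_)
  rw [heq]; exact hcomp

/-! ### The modulus of the equation of state -/

/-- **Uniform continuity of `t ↦ t f_ex(tσ³)` below the band edge**: for `EosBand η₀ F`, `σ > 0` and `T ≥ 0` with `Tσ³ < η₀`,
every `ε > 0` admits `δ > 0` such that `|s f_ex(sσ³) − t f_ex(tσ³)| < ε` for all `s, t ∈ [0, T']` with `|s − t| < δ`, where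
`T' σ³ < η₀` as well — stated with the a-priori range `[0, T]` for `t` and `s ≥ 0`, `|s − t| < δ` (then `s` is in the band too). -/
theorem pw_eos_modulus : ∀ {η₀ σ : ℝ} {F : ℝ → ℝ}, EosBand η₀ F → 0 < σ → ∀ {T : ℝ}, 0 ≤ T → T * σ ^ 3 < η₀ → ∀ {ε : ℝ}, 0 < ε → ∃ δ : ℝ, 0 < δ ∧ ∀ t ∈ Set.Icc 0 T, ∀ s, 0 ≤ s → |s - t| < δ → s * σ ^ 3 < η₀ ∧ |s * hsExcessFreeEnergy (s * σ ^ 3) - t * hsExcessFreeEnergy (t * σ ^ 3)| < ε := by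
  intro η₀ σ F hB hσ T hT0 hT ε hε
  have hη₀ := hB.1
  have hσ3 : 0 < σ ^ 3 := by positivity
  set U : Set ℝ := (fun t => t * σ ^ 3) ⁻¹' Set.Ioo (-η₀) η₀ with hU
  have hUo : IsOpen U := isOpen_Ioo.preimage (continuous_id.mul continuous_const)
  have hKU : Set.Icc 0 T ⊆ U := fun t ht =>
    ⟨by nlinarith [ht.1], lt_of_le_of_lt (mul_le_mul_of_nonneg_right ht.2 hσ3.le) hT⟩
  set g : ℝ → ℝ := fun t => t * F (t * σ ^ 3) with hg
  have hgc : ContinuousOn g U :=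
    continuousOn_id.mul (hB.2.1.continuousOn.comp (continuous_id.mul continuous_const).continuousOn fun t ht => ht)
  obtain ⟨δ, hδ, H⟩ := initL_unif_near_compact hUo isCompact_Icc hKU hgc hε
  refine ⟨δ, hδ, fun t ht s hs0 hst => ?_⟩
  have hq : dist s t < δ := by rwa [Real.dist_eq]
  obtain ⟨hsU, hgd⟩ := H t ht s hq
  have hsband : s * σ ^ 3 < η₀ := hsU.2
  refine ⟨hsband, ?_⟩
  have es : hsExcessFreeEnergy (s * σ ^ 3) = F (s * σ ^ 3) := hB.2.2 ⟨mul_nonneg hs0 hσ3.le, hsband⟩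
  have et : hsExcessFreeEnergy (t * σ ^ 3) = F (t * σ ^ 3) :=
    hB.2.2 ⟨mul_nonneg ht.1 hσ3.le, lt_of_le_of_lt (mul_le_mul_of_nonneg_right ht.2 hσ3.le) hT⟩
  rw [es, et, ← Real.dist_eq]
  exact hgd

end Summit.AtomisticToContinuum.HydrodynamicLimit.Theorems.LocalSecondLawInitialMatching

end
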